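import Literature.AnabelianGeometry.SemiGraphs.UniversalCovering

/-!
# The universal graph-covering of a semi-graph is connected

Companion of `UniversalCovering.lean` ([SemiAnbd] §1 p. 15; used on p. 38 for `𝒢_{∞,i}`): every
node of the universal graph-covering `𝔾̃` of `𝔾` based at `c₀` is reachable, in the barycentric
subdivision of `𝔾̃`, from the base node (the class of the trivial path at `c₀`); in particular
`𝔾̃` is connected (`univCover_isConnected`) — for ANY semi-graph `𝔾` and any base component
(vertex or edge); no connectedness hypothesis on `𝔾` is needed (only the component of `c₀` is
covered by `𝔾̃`).

Proof: a morphism `c₀ ⟶ c` of the fundamental groupoid is represented by a zigzag of branches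
`b : e → v` of `Cat(𝔾)`; each step `(e, p) ↦ (v, p ≫ b)` (or its reverse) is two adjacencies
`edge – branch – vertex` of the subdivision of `𝔾̃`.
-/

namespace Literature.AnabelianGeometry.SemiGraphs

namespace SemiGraph

open CategoryTheory

universe u

variable (G : SemiGraph.{u}) (c₀ : G.CatCarrier)

/-- The node of (the barycentric subdivision of) `𝔾̃` attached to an object `a` of the fundamental
groupoid and a morphism `q : c₀ ⟶ a`: the vertex `(v, q)` if `a = v`, the edge `(e, q)` if `a = e`.
[cite: MochizukiSemiAnbd2006, §1 p.15] -/
def univCoverNode : (a : Quiver.FreeGroupoid G.CatCarrier) → (G.basept c₀ ⟶ a) →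
    (G.univCover c₀).Node
  | ⟨Sum.inl v⟩, q => Sum.inl ⟨v, q⟩
  | ⟨Sum.inr e⟩, q => Sum.inr (Sum.inl ⟨e, q⟩)

/-- The class, in the free groupoid on `Cat(𝔾)`, of the REVERSED arrow of a branch `b : e → v`
(a morphism `v ⟶ e`). [cite: MochizukiSemiAnbd2006, Def. 2.11 p.32] -/
noncomputable def brArrowRev (b : G.Branch) (e : G.Edge) (v : G.Vertex) (he : G.edgeOf b = e)
    (hv : G.abuts b = some v) : G.basept (Sum.inl v) ⟶ G.basept (Sum.inr e) :=
  (CategoryTheory.Quotient.functor (@Quiver.FreeGroupoid.redStep G.CatCarrier G.catQuiver)).map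
    (@Quiver.Hom.toPath (Quiver.Symmetrify G.CatCarrier)
      (@Quiver.symmetrifyQuiver G.CatCarrier G.catQuiver) (Sum.inl v) (Sum.inr e)
      (Sum.inr (⟨b, he, hv⟩ : CatArrow (Sum.inr e) (Sum.inl v))))

/-- `b⁻¹ ≫ b = 𝟙` in the free groupoid (its defining relation).
[cite: MochizukiSemiAnbd2006, Def. 2.11 p.32] -/
theorem brArrowRev_comp_brArrow (b : G.Branch) (e : G.Edge) (v : G.Vertex)
    (he : G.edgeOf b = e) (hv : G.abuts b = some v) :
    G.brArrowRev b e v he hv ≫ G.brArrow b e v he hv = 𝟙 _ := by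
  have h := CategoryTheory.Quotient.sound (@Quiver.FreeGroupoid.redStep G.CatCarrier G.catQuiver)
    (@Quiver.FreeGroupoid.redStep.step G.CatCarrier G.catQuiver (Sum.inl v) (Sum.inr e)
      (Sum.inr (⟨b, he, hv⟩ : CatArrow (Sum.inr e) (Sum.inl v))))
  rw [CategoryTheory.Functor.map_id, CategoryTheory.Functor.map_comp] at h
  exact h.symm

/-- Hence `brArrowRev b = (brArrow b)⁻¹`. [cite: MochizukiSemiAnbd2006, Def. 2.11 p.32] -/
theorem brArrowRev_eq_inv (b : G.Branch) (e : G.Edge) (v : G.Vertex)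
    (he : G.edgeOf b = e) (hv : G.abuts b = some v) :
    G.brArrowRev b e v he hv = inv (G.brArrow b e v he hv) :=
  IsIso.eq_inv_of_inv_hom_id (G.brArrowRev_comp_brArrow b e v he hv)

variable {G c₀} in
/-- An edge node and a vertex node of `𝔾̃` joined by a branch are mutually reachable.
[cite: MochizukiSemiAnbd2006, §1 p.15] -/
private theorem reachable_of_abuts (e : G.Edge) (p : G.basept c₀ ⟶ G.basept (Sum.inr e))
    (b : G.Branch) (hb : G.edgeOf b = e) (vt : (G.univCover c₀).Vertex)
    (h : (G.univCover c₀).abuts ⟨⟨e, p⟩, ⟨b, hb⟩⟩ = some vt) :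
    (G.univCover c₀).subdivision.Reachable (Sum.inr (Sum.inl ⟨e, p⟩)) (Sum.inl vt) := by
  have h1 : (G.univCover c₀).subdivision.Reachable (Sum.inr (Sum.inl ⟨e, p⟩))
      (Sum.inr (Sum.inr ⟨⟨e, p⟩, ⟨b, hb⟩⟩)) := by
    refine SimpleGraph.Adj.reachable ?_
    rw [SemiGraph.subdivision, SimpleGraph.fromRel_adj]
    exact ⟨by simp, Or.inl (@NodeRel.edge_branch (G.univCover c₀) ⟨⟨e, p⟩, ⟨b, hb⟩⟩)⟩
  have h2 : (G.univCover c₀).subdivision.Reachable (Sum.inr (Sum.inr ⟨⟨e, p⟩, ⟨b, hb⟩⟩))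
      (Sum.inl vt) := by
    refine SimpleGraph.Adj.reachable ?_
    rw [SemiGraph.subdivision, SimpleGraph.fromRel_adj]
    exact ⟨by simp, Or.inl (@NodeRel.branch_vertex (G.univCover c₀) ⟨⟨e, p⟩, ⟨b, hb⟩⟩ vt h)⟩
  exact h1.trans h2

variable {G c₀} in
/-- One zigzag step: along an arrow `g` of the symmetrised quiver `Cat(𝔾)`, the node of `(y, r)`
reaches the node of `(z, r ≫ [g])`. [cite: MochizukiSemiAnbd2006, §1 p.15] -/
private theorem reachable_step (y z : G.CatCarrier)
    (g : @Quiver.Hom (Quiver.Symmetrify G.CatCarrier)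
      (@Quiver.symmetrifyQuiver G.CatCarrier G.catQuiver) y z)
    (r : G.basept c₀ ⟶ G.basept y) :
    (G.univCover c₀).subdivision.Reachable (G.univCoverNode c₀ (G.basept y) r)
      (G.univCoverNode c₀ (G.basept z) (r ≫
        (CategoryTheory.Quotient.functor (@Quiver.FreeGroupoid.redStep G.CatCarrier G.catQuiver)).map
          (@Quiver.Hom.toPath (Quiver.Symmetrify G.CatCarrier)
            (@Quiver.symmetrifyQuiver G.CatCarrier G.catQuiver) y z g))) := by
  revert g r
  refine Sum.rec (fun v => ?_) (fun e => ?_) y <;> refine Sum.rec (fun v' => ?_) (fun e' => ?_) z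
    <;> intro g r <;> rcases g with g | g
  · exact g.elim
  · exact g.elim
  · exact g.elim
  · -- reversed branch arrow `g = b : e' → v`: `(v, r) ~ (e', r ≫ b⁻¹)`
    obtain ⟨b, he, hv⟩ := g
    change (G.univCover c₀).subdivision.Reachable (Sum.inl ⟨v, r⟩)
      (Sum.inr (Sum.inl ⟨e', r ≫ G.brArrowRev b e' v he hv⟩))
    refine SimpleGraph.Reachable.symm (reachable_of_abuts e' _ b he ⟨v, r⟩ ?_)
    rw [G.univCover_abuts_of_abuts c₀ e' _ b he v hv, Category.assoc, brArrowRev_comp_brArrow,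
      Category.comp_id]
  · -- branch arrow `g = b : e → v'`: `(e, r) ~ (v', r ≫ b)`
    obtain ⟨b, he, hv⟩ := g
    exact reachable_of_abuts e r b he ⟨v', _⟩ (G.univCover_abuts_of_abuts c₀ e r b he v' hv)
  · exact g.elim
  · exact g.elim
  · exact g.elim

/-- Along any morphism `f : a ⟶ a'` of the fundamental groupoid, the node of `(a, q)` reaches the
node of `(a', q ≫ f)` in the subdivision of `𝔾̃`. [cite: MochizukiSemiAnbd2006, §1 p.15] -/
theorem univCoverNode_reachable {a a' : Quiver.FreeGroupoid G.CatCarrier} (f : a ⟶ a')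
    (q : G.basept c₀ ⟶ a) :
    (G.univCover c₀).subdivision.Reachable (G.univCoverNode c₀ a q)
      (G.univCoverNode c₀ a' (q ≫ f)) := by
  revert q
  refine CategoryTheory.Quotient.induction (r := @Quiver.FreeGroupoid.redStep G.CatCarrier G.catQuiver)
    (P := fun {x y} f => ∀ (q : G.basept c₀ ⟶ x), (G.univCover c₀).subdivision.Reachable
      (G.univCoverNode c₀ x q) (G.univCoverNode c₀ y (q ≫ f))) ?_ f
  intro x' y' path
  induction path with
  | nil =>
    intro q
    have hid : (CategoryTheory.Quotient.functor
        (@Quiver.FreeGroupoid.redStep G.CatCarrier G.catQuiver)).map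
          (𝟙 ((Paths.of (Quiver.Symmetrify G.CatCarrier)).obj x')) = 𝟙 _ :=
      CategoryTheory.Functor.map_id _ _
    exact hid ▸ (Category.comp_id q).symm ▸ SimpleGraph.Reachable.refl _
  | cons path g ih =>
    intro q
    rename_i y'' z
    have hcons : (CategoryTheory.Quotient.functor
        (@Quiver.FreeGroupoid.redStep G.CatCarrier G.catQuiver)).map
          (@Quiver.Path.cons (Quiver.Symmetrify G.CatCarrier)
            (@Quiver.symmetrifyQuiver G.CatCarrier G.catQuiver) x' y'' z path g) =
        (CategoryTheory.Quotient.functor (@Quiver.FreeGroupoid.redStep G.CatCarrier G.catQuiver)).map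
          path ≫
        (CategoryTheory.Quotient.functor (@Quiver.FreeGroupoid.redStep G.CatCarrier G.catQuiver)).map
          (@Quiver.Hom.toPath (Quiver.Symmetrify G.CatCarrier)
            (@Quiver.symmetrifyQuiver G.CatCarrier G.catQuiver) y'' z g) := by
      rw [← CategoryTheory.Functor.map_comp]
      rfl
    have key : (q ≫ (CategoryTheory.Quotient.functor
          (@Quiver.FreeGroupoid.redStep G.CatCarrier G.catQuiver)).map path) ≫
        (CategoryTheory.Quotient.functor (@Quiver.FreeGroupoid.redStep G.CatCarrier G.catQuiver)).map
          (@Quiver.Hom.toPath (Quiver.Symmetrify G.CatCarrier)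
            (@Quiver.symmetrifyQuiver G.CatCarrier G.catQuiver) y'' z g) =
        q ≫ (CategoryTheory.Quotient.functor
          (@Quiver.FreeGroupoid.redStep G.CatCarrier G.catQuiver)).map
          (@Quiver.Path.cons (Quiver.Symmetrify G.CatCarrier)
            (@Quiver.symmetrifyQuiver G.CatCarrier G.catQuiver) x' y'' z path g) := by
      rw [hcons]
      exact Category.assoc _ _ _
    exact key ▸ (ih q).trans (reachable_step y'' z g _)

/-- **The universal graph-covering `𝔾̃` of a semi-graph (based at any component) is connected**:
every node of its barycentric subdivision is reachable from the base node.
[cite: MochizukiSemiAnbd2006, §1 p.15] -/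
theorem univCover_isConnected : (G.univCover c₀).IsConnected := by
  have hbase : ∀ (a : Quiver.FreeGroupoid G.CatCarrier) (q : G.basept c₀ ⟶ a),
      (G.univCover c₀).subdivision.Reachable (G.univCoverNode c₀ (G.basept c₀) (𝟙 _))
        (G.univCoverNode c₀ a q) := by
    intro a q
    have h := G.univCoverNode_reachable c₀ q (𝟙 _)
    rwa [Category.id_comp] at h
  have hall : ∀ x : (G.univCover c₀).Node, (G.univCover c₀).subdivision.Reachable
      (G.univCoverNode c₀ (G.basept c₀) (𝟙 _)) x := by
    rintro (⟨v, p⟩ | ⟨e, p⟩ | ⟨⟨e, p⟩, ⟨b, hb⟩⟩)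
    · exact hbase (G.basept (Sum.inl v)) p
    · exact hbase (G.basept (Sum.inr e)) p
    · have h1 : (G.univCover c₀).subdivision.Reachable (Sum.inr (Sum.inl ⟨e, p⟩))
          (Sum.inr (Sum.inr ⟨⟨e, p⟩, ⟨b, hb⟩⟩)) := by
        refine SimpleGraph.Adj.reachable ?_
        rw [SemiGraph.subdivision, SimpleGraph.fromRel_adj]
        exact ⟨by simp, Or.inl (@NodeRel.edge_branch (G.univCover c₀) ⟨⟨e, p⟩, ⟨b, hb⟩⟩)⟩
      exact (hbase (G.basept (Sum.inr e)) p).trans h1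
  haveI : Nonempty (G.univCover c₀).Node := ⟨G.univCoverNode c₀ (G.basept c₀) (𝟙 _)⟩
  exact ⟨⟨fun x y => (hall x).symm.trans (hall y)⟩⟩

end SemiGraph

end Literature.AnabelianGeometry.SemiGraphs
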